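import Summits.Ventures.PackingBounds.Configurations.IcosahedronEnergyRigidity

/-!
# Twelve-point ground states on `S²` are six equiangular lines (central symmetry of icosahedral ground states)

Framing: lottery ticket; floor = certified bounds/negative ranges. Venture `PackingBounds` (cell
`pub-packcert`, seat `pub-packcert-energy`) — a structural step towards the uniqueness of the icosahedron as a
ground state (Cohn–Kumar Table 1, row `(3, 12)`).

`IcosahedronEnergyRigidity.inner_mem_of_ckPow_energy_eq` says a 12-point ground state of `(1+t)^k` (`k ≥ 6`) on `S²`
has all inner products in `{-1} ∪ {t : t² = 1/5}`. Here: (1) **at most six equiangular unit vectors in `ℝ³`**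
at `cos² = 1/5` (`card_le_six_of_sq_inner_eq`; Gerzon-type bound via the Veronese map `u ↦ (u_i u_j) ∈ ℝ⁶`, whose
Gram matrix `(4/5) I + (1/5) J` is nonsingular), hence (2) such a 12-point configuration is **centrally symmetric and
consists of six equiangular lines** (`exists_six_lines`: `C = T ∪ (-T)`, `|T| = 6`, `T` pairwise at `cos² = 1/5`), in
particular every point has its antipode in `C` (`neg_mem`). The remaining step to full uniqueness (the six lines are the
icosahedron's diagonals: Seidel switching to the pentagon two-graph) is not formalised here.

## References
* H. Cohn, A. Kumar, J. Amer. Math. Soc. 20 (2007) 99–148, Table 1. [`CohnKumar2006`]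
* P. W. H. Lemmens, J. J. Seidel, *Equiangular lines*, J. Algebra 24 (1973) 494–512 (Gerzon's bound).
-/

noncomputable section

namespace Summit.Ventures.PackingBounds.Config.IcosahedronLines

open Finset Module

/-- `(√2)² = 2`. -/
private theorem s2sq : Real.sqrt 2 ^ 2 = 2 := Real.sq_sqrt (by norm_num)

/-- The Veronese (feature) map `ℝ³ → ℝ⁶`, `u ↦ (u₀², u₁², u₂², √2 u₀u₁, √2 u₀u₂, √2 u₁u₂)`. -/
def ver (u : EuclideanSpace ℝ (Fin 3)) : EuclideanSpace ℝ (Fin 6) :=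
  WithLp.toLp 2 ![u 0 ^ 2, u 1 ^ 2, u 2 ^ 2, Real.sqrt 2 * (u 0 * u 1), Real.sqrt 2 * (u 0 * u 2),
    Real.sqrt 2 * (u 1 * u 2)]

/-- The inner product of `ℝ³` in coordinates. [folklore] -/
private theorem inner_three (x y : EuclideanSpace ℝ (Fin 3)) :
    inner ℝ x y = x 0 * y 0 + x 1 * y 1 + x 2 * y 2 := by
  simp [PiLp.inner_apply, Fin.sum_univ_three, mul_comm]

/-- **The Veronese map squares inner products**: `⟪ver u, ver v⟫ = ⟪u, v⟫²`. -/
theorem inner_ver (u v : EuclideanSpace ℝ (Fin 3)) : inner ℝ (ver u) (ver v) = inner ℝ u v ^ 2 := by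
  have h2 := s2sq
  rw [inner_three]
  simp only [ver, PiLp.inner_apply, EuclideanSpace, Fin.sum_univ_succ, Fin.sum_univ_zero]
  simp [mul_comm]
  linear_combination (u 0 * u 1 * (v 0 * v 1) + u 0 * u 2 * (v 0 * v 2) + u 1 * u 2 * (v 1 * v 2)) * h2

/-- **Gerzon-type bound at `cos² = 1/5` in `ℝ³`**: at most `6` unit vectors with pairwise squared inner products
`1/5` (the Veronese images have the nonsingular Gram matrix `(4/5)I + (1/5)J` in `ℝ⁶`). [folklore] -/
theorem card_le_six_of_sq_inner_eq (T : Finset (EuclideanSpace ℝ (Fin 3))) (h1 : ∀ x ∈ T, ‖x‖ = 1)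
    (h5 : ∀ x ∈ T, ∀ y ∈ T, x ≠ y → inner ℝ x y ^ 2 = 1 / 5) : T.card ≤ 6 := by
  classical
  -- the Veronese images are linearly independent
  have hlin : LinearIndependent ℝ (fun x : T => ver (x : EuclideanSpace ℝ (Fin 3))) := by
    rw [linearIndependent_iff']
    intro s a hsum i hi
    -- pair the relation with `ver x_j`: `(4/5) a_j + (1/5) Σ_{i ∈ s} a_i = 0`
    have hpair : ∀ j ∈ s, (4 / 5 : ℝ) * a j + (1 / 5 : ℝ) * ∑ i ∈ s, a i = 0 := by
      intro j hj
      have h := congrArg (fun z => inner ℝ z (ver (j : EuclideanSpace ℝ (Fin 3)))) hsum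
      simp only [sum_inner, real_inner_smul_left, inner_zero_left] at h
      have hij : ∀ i ∈ s, a i * inner ℝ (ver (i : EuclideanSpace ℝ (Fin 3))) (ver (j : EuclideanSpace ℝ (Fin 3))) =
          a i * (if i = j then 1 else 1 / 5) := by
        intro i _
        rw [inner_ver]
        by_cases hij : i = j
        · subst hij; rw [if_pos rfl, real_inner_self_eq_norm_sq, h1 _ i.2]; norm_num
        · rw [if_neg hij, h5 _ i.2 _ j.2 fun h => hij (Subtype.ext h)]
      rw [Finset.sum_congr rfl hij] at h
      have hsplit' : ∀ i ∈ s, a i * (if i = j then (1 : ℝ) else 1 / 5) =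
          (1 / 5 : ℝ) * a i + (if i = j then (4 / 5 : ℝ) * a i else 0) := by
        intro i _; split_ifs <;> ring
      rw [Finset.sum_congr rfl hsplit', Finset.sum_add_distrib, ← Finset.mul_sum, Finset.sum_ite_eq' s j,
        if_pos hj] at h
      linarith
    -- sum over j: `(4/5 + |s|/5) Σ a = 0`, so `Σ a = 0`, so each `a_j = 0`
    have htot : ∑ j ∈ s, ((4 / 5 : ℝ) * a j + (1 / 5 : ℝ) * ∑ i ∈ s, a i) = 0 :=
      Finset.sum_eq_zero hpair
    rw [Finset.sum_add_distrib, ← Finset.mul_sum, Finset.sum_const, nsmul_eq_mul] at htot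
    have hS : ∑ i ∈ s, a i = 0 := by
      have hc : (0 : ℝ) ≤ s.card := by positivity
      nlinarith [sq_nonneg (∑ i ∈ s, a i)]
    have := hpair i hi
    rw [hS] at this
    linarith
  have h := hlin.fintype_card_le_finrank
  rw [finrank_euclideanSpace_fin, Fintype.card_coe] at h
  exact h

/-- Unit vectors with inner product `-1` are antipodal. [folklore] -/
private theorem eq_neg {x y : EuclideanSpace ℝ (Fin 3)} (hx : ‖x‖ = 1) (hy : ‖y‖ = 1)
    (h : inner ℝ x y = -1) : y = -x := by
  have h0 : ‖x + y‖ ^ 2 = 0 := by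
    rw [← real_inner_self_eq_norm_sq, inner_add_left, inner_add_right, inner_add_right,
      real_inner_self_eq_norm_sq, real_inner_self_eq_norm_sq, hx, hy, real_inner_comm x y, h]
    norm_num
  have : x + y = 0 := norm_eq_zero.mp (pow_eq_zero_iff two_ne_zero |>.mp h0)
  exact (neg_eq_of_add_eq_zero_right this).symm

/-- `y ≠ -y` for a unit vector. -/
private theorem ne_neg_self {y : EuclideanSpace ℝ (Fin 3)} (hy : ‖y‖ = 1) : -y ≠ y := by
  intro h
  have h2 : y + y = 0 := by nth_rewrite 1 [← h]; exact neg_add_cancel y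
  have h3 : (2 : ℝ) • y = 0 := by rwa [two_smul]
  have : y = 0 := (smul_eq_zero.mp h3).resolve_left two_ne_zero
  rw [this, norm_zero] at hy; exact zero_ne_one hy

section config

variable {C : Finset (EuclideanSpace ℝ (Fin 3))} (h1 : ∀ x ∈ C, ‖x‖ = 1) (hN : C.card = 12)
  (hv : ∀ x ∈ C, ∀ y ∈ C, x ≠ y → inner ℝ x y = -1 ∨ inner ℝ x y ^ 2 = 1 / 5)
include h1 hN hv

/-- **Six equiangular lines.** A `12`-point configuration on `S²` with all inner products in `{-1} ∪ {t² = 1/5}`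
splits as `C = T ∪ (-T)` with `|T| = 6` and `T` equiangular (`⟪x,y⟫² = 1/5` for distinct `x, y ∈ T`). -/
theorem exists_six_lines : ∃ T : Finset (EuclideanSpace ℝ (Fin 3)), T ⊆ C ∧ T.card = 6 ∧
    (∀ x ∈ T, ∀ y ∈ T, x ≠ y → inner ℝ x y ^ 2 = 1 / 5) ∧ C = T ∪ T.image (fun x => -x) := by
  classical
  let S := C.powerset.filter fun R => ∀ x ∈ R, -x ∉ R
  have hSne : S.Nonempty := ⟨∅, by simp [S]⟩
  obtain ⟨T, hTS, hTmax⟩ := Finset.exists_max_image S Finset.card hSne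
  simp only [S, mem_filter, mem_powerset] at hTS
  obtain ⟨hTC, hTfree⟩ := hTS
  -- `T` is equiangular
  have hequi : ∀ x ∈ T, ∀ y ∈ T, x ≠ y → inner ℝ x y ^ 2 = 1 / 5 := by
    intro x hx y hy hxy
    rcases hv x (hTC hx) y (hTC hy) hxy with h | h
    · exact absurd (eq_neg (h1 x (hTC hx)) (h1 y (hTC hy)) h ▸ hy) (hTfree x hx)
    · exact h
  have hTle : T.card ≤ 6 := card_le_six_of_sq_inner_eq T (fun x hx => h1 x (hTC hx)) hequi
  -- covering
  have hcover : ∀ x ∈ C, x ∈ T ∨ -x ∈ T := by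
    intro x hx
    by_contra hnot
    push Not at hnot
    obtain ⟨hxT, hnxT⟩ := hnot
    have hins : insert x T ∈ S := by
      simp only [S, mem_filter, mem_powerset]
      refine ⟨Finset.insert_subset hx hTC, fun y hy => ?_⟩
      rcases Finset.mem_insert.mp hy with rfl | hyT
      · rw [Finset.mem_insert, not_or]
        exact ⟨ne_neg_self (h1 y hx), hnxT⟩
      · rw [Finset.mem_insert, not_or]
        exact ⟨fun h => hnxT (by rw [← h, neg_neg]; exact hyT), hTfree y hyT⟩
    have := hTmax _ hins
    rw [Finset.card_insert_of_notMem hxT] at this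
    omega
  have hsub : C ⊆ T ∪ T.image (fun x => -x) := by
    intro x hx
    rcases hcover x hx with h | h
    · exact Finset.mem_union_left _ h
    · exact Finset.mem_union_right _ (Finset.mem_image.mpr ⟨-x, h, neg_neg x⟩)
  have hUle : (T ∪ T.image (fun x => -x)).card ≤ T.card + T.card :=
    (Finset.card_union_le _ _).trans (Nat.add_le_add_left Finset.card_image_le _)
  have hcardT : T.card = 6 := by
    have := Finset.card_le_card hsub; omega
  exact ⟨T, hTC, hcardT, hequi, Finset.eq_of_subset_of_card_le hsub (by omega)⟩

/-- **Central symmetry.** Such a configuration contains the antipode of each of its points. -/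
theorem neg_mem {x : EuclideanSpace ℝ (Fin 3)} (hx : x ∈ C) : -x ∈ C := by
  classical
  obtain ⟨T, _, _, _, hC⟩ := exists_six_lines h1 hN hv
  rw [hC] at hx ⊢
  rcases Finset.mem_union.mp hx with h | h
  · exact Finset.mem_union_right _ (Finset.mem_image_of_mem _ h)
  · obtain ⟨y, hy, rfl⟩ := Finset.mem_image.mp h
    rw [neg_neg]; exact Finset.mem_union_left _ hy

end config

/-- **Icosahedral ground states are six equiangular lines.** A `12`-point configuration on `S²` attaining the
universal lower bound of the `(1+t)^k`-energy for one `k ≥ 6` is centrally symmetric and splits as `T ∪ (-T)` with `T`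
six equiangular unit vectors at `cos² = 1/5` (the structure of the icosahedron's six diagonals).
[cite: CohnKumar2006, Theorem 1.2 and Table 1] -/
theorem six_lines_of_ckPow_energy_eq {C : Finset (EuclideanSpace ℝ (Fin 3))} (h1 : ∀ x ∈ C, ‖x‖ = 1)
    (hN : C.card = 12) (k : ℕ) (hk : 6 ≤ k)
    (hE : ∑ x ∈ C, ∑ y ∈ C.erase x, (1 + inner ℝ x y) ^ k =
      (12 : ℝ) * ((1 + (-1 : ℝ)) ^ k + 5 * (1 + (-(Real.sqrt 5 / 5))) ^ k
        + 5 * (1 + Real.sqrt 5 / 5) ^ k)) :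
    (∀ x ∈ C, -x ∈ C) ∧ ∃ T : Finset (EuclideanSpace ℝ (Fin 3)), T ⊆ C ∧ T.card = 6 ∧
      (∀ x ∈ T, ∀ y ∈ T, x ≠ y → inner ℝ x y ^ 2 = 1 / 5) ∧ C = T ∪ T.image (fun x => -x) := by
  have hv := IcosahedronEnergyRigidity.inner_mem_of_ckPow_energy_eq h1 hN k hk hE
  exact ⟨fun x hx => neg_mem h1 hN hv hx, exists_six_lines h1 hN hv⟩

end Summit.Ventures.PackingBounds.Config.IcosahedronLines

end
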